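import Mathlib
import Summits.ValiantsHypothesis.ValiantsHypothesis.Theorems.NewtonUnitEquationsTwoProductsRankOneFourLawPlanar
import Summits.ValiantsHypothesis.ValiantsHypothesis.Theorems.TwoProducts.Negative.ClassCoverSharedAlphabet
import HarnessLib

/-!
# `TwoProducts` (stmt-ValiantsHypothesis-5906), line `relation_ladder` — NEGATIVE lane: the TWO-SIDED shape `α + 2β = γ + δ`
# escapes every ONE-SIDED rank-one clause (R6b … R7c, the typed R8) and the UNIT four-term clause (R6)

Helper file of the Negative lane (val-neg-1 g4; `--supports stmt-ValiantsHypothesis-5906`; closes NO item).  Kernel form of the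
RANK-ONE half of the first-inhabitant analysis of `ResidualLawV20` / V21 (evidence #44 on the item, memo
`NOTE-neg1g4-5906-V20-inhabitants-R8-preaudit.md` §1 (ii)): after R8 (one-sided `p·α = Σ q_i β_i`) the cheapest rank-one inhabitant of
the residual is the two-sided non-unit shape `α + 2β = γ + δ` on four distinct non-zero letters.  Take a SHARED alphabet `A l = E`
containing such letters and three distinct positions `i, j, k` (`m ≥ 3`).  The coincidence `(α | β | β) ~ (γ | δ | 0)` has letter
multisets `P = e_α + 2e_β`, `Q = e_γ + e_δ`: TWO letters where `P` exceeds `Q` and TWO where `Q` exceeds `P`, with excesses of modulus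
`1` (at `α`) and `2` (at `β`).  Two datum-level obstructions follow, with NO reference to a particular clause:

* `no_oneSided_datum` — no datum `(ρ⁺, ρ⁻)` one of whose strict-excess sets (`{e | ρ⁺ e < ρ⁻ e}` or `{e | ρ⁻ e < ρ⁺ e}`) has at most
  one letter satisfies `RankOneCoincidences A ρ⁺ ρ⁻` (tree, `…RankOneFourLawPlanar`): a `k`-shift transports the two excess letters of
  one side of the coincidence into that set.  Every ONE-SIDED datum (`ρ⁻ = p·e_α'` or `ρ⁺ = p·e_β'`: R6b, R6c, R7a, R6d, R7b, R7c and the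
  typed R8 target `OneSidedRankOne`, any number of plus-letters) is of this kind (`oneSided_of_single_right/_left`).
* `no_unit_datum` — no `{0,1}`-valued datum fits: the modulus-2 excess at `β` forces `k = 2`, the modulus-1 excess at `α` then
  contradicts parity.  R6's datum `(e_γ' + e_δ', e_α' + e_β')` on distinct letters is `{0,1}`-valued.
* Hence `escapes_residualV20_and_R8_clauses`: the family satisfies ALL SEVEN `¬`-clauses of `ResidualLawV20`
  (`Cruxes/TwoProducts/Lines/relation_ladder.lean` v20 — Cruxes files are not importable, so the clause bodies are restated verbatim inside
  the conjunction) AND the negation of R8's typed target `OneSidedRankOne` (`Lines/relation_ladder_sketch_R8.lean`, body verbatim), as one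
  eight-fold conjunction (the rank-two family of `…Negative.RankTwoEscapes` has the single clauses by name).
* Non-vacuity of the letter hypotheses: `example_escapes` — `β = (3,0), α = (0,1), γ = (1,0), δ = (5,1)` (`α + 2β = γ + δ = (6,1)`), m = 3.

READING (information for the line owner, not an objection): a rung removing this family needs a datum with ≥ 2 excess letters on EACH
side and a non-unit coefficient — the two-substituted-letter («transportation») lift of memo `relation_ladder_R7_engine.md` rev 2 (R9), not
the one-letter monomial substitution of the R7b/R8 engine.  Honest framing: `TwoProducts` (5906), the residual LAW and VP ≠ VNP are NOT
proved here and are not claimed. [folklore]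
-/

namespace Summit.ValiantsHypothesis.Theorems.TwoProducts.Negative.TwoSidedEscape

open Finset
open Summit.ValiantsHypothesis.ValiantsHypothesis.Theorems.NewtonUnitEquations.TwoProducts.FormalLogLinearisation (Expo)
open Summit.ValiantsHypothesis.ValiantsHypothesis.Theorems.NewtonUnitEquations.TwoProducts.PlanarCell (tuples)
open Summit.ValiantsHypothesis.ValiantsHypothesis.Theorems.NewtonUnitEquations.TwoProducts.PermutationType
  (msetT RankOneCoincidences)
open Summit.ValiantsHypothesis.Theorems.TwoProducts.Negative.ClassCoverBound

variable {m : ℕ}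

/-! ### Datum-level obstructions from ONE coincidence `P + k•ρ⁺ = Q + k•ρ⁻` (or swapped) -/

/-- Transport of a strict excess: from `x + k*a = y + k*b` and `y < x` get `a < b`. [folklore] -/
theorem lt_of_shift {x y a b k : ℕ} (h : x + k * a = y + k * b) (hyx : y < x) : a < b :=
  Nat.lt_of_mul_lt_mul_left (a := k) (by omega)

/-- **No one-sided datum.**  If `P, Q : Expo →₀ ℕ` differ with `Q < P` at two distinct letters `e₁, e₂` and `P < Q` at two distinct
letters `f₁, f₂`, then no `k`-shift relates them to a datum `(ρp, ρm)` one of whose strict-excess sets has at most one letter. [folklore] -/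
theorem no_shift_of_oneSided {P Q ρp ρm : Expo →₀ ℕ} {e₁ e₂ f₁ f₂ : Expo} (he : e₁ ≠ e₂) (hf : f₁ ≠ f₂)
    (he₁ : Q e₁ < P e₁) (he₂ : Q e₂ < P e₂) (hf₁ : P f₁ < Q f₁) (hf₂ : P f₂ < Q f₂)
    (hone : (∀ e e', ρp e < ρm e → ρp e' < ρm e' → e = e') ∨ (∀ e e', ρm e < ρp e → ρm e' < ρp e' → e = e')) (k : ℕ) :
    ¬ (P + k • ρp = Q + k • ρm ∨ Q + k • ρp = P + k • ρm) := by
  have ev : ∀ {X Y : Expo →₀ ℕ}, X + k • ρp = Y + k • ρm → ∀ e, X e + k * ρp e = Y e + k * ρm e := fun h e => by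
    have := DFunLike.congr_fun h e
    simpa only [Finsupp.add_apply, Finsupp.smul_apply, smul_eq_mul] using this
  rintro (h | h)
  · rcases hone with h1 | h1
    · exact he (h1 e₁ e₂ (lt_of_shift (ev h e₁) he₁) (lt_of_shift (ev h e₂) he₂))
    · exact hf (h1 f₁ f₂ (lt_of_shift (ev h f₁).symm hf₁) (lt_of_shift (ev h f₂).symm hf₂))
  · rcases hone with h1 | h1
    · exact hf (h1 f₁ f₂ (lt_of_shift (ev h f₁) hf₁) (lt_of_shift (ev h f₂) hf₂))
    · exact he (h1 e₁ e₂ (lt_of_shift (ev h e₁).symm he₁) (lt_of_shift (ev h e₂).symm he₂))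

/-- **No unit datum.**  If `P e₁ = Q e₁ + 1` and `P e₂ = Q e₂ + 2` at two letters, then no `k`-shift relates `P, Q` to a
`{0,1}`-valued datum (`k = 2` is forced at `e₂`, parity fails at `e₁`). [folklore] -/
theorem no_shift_of_unit {P Q ρp ρm : Expo →₀ ℕ} {e₁ e₂ : Expo} (he₁ : P e₁ = Q e₁ + 1) (he₂ : P e₂ = Q e₂ + 2)
    (hp : ∀ e, ρp e ≤ 1) (hm : ∀ e, ρm e ≤ 1) (k : ℕ) :
    ¬ (P + k • ρp = Q + k • ρm ∨ Q + k • ρp = P + k • ρm) := by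
  have ev : ∀ {X Y : Expo →₀ ℕ}, X + k • ρp = Y + k • ρm → ∀ e, X e + k * ρp e = Y e + k * ρm e := fun h e => by
    have := DFunLike.congr_fun h e
    simpa only [Finsupp.add_apply, Finsupp.smul_apply, smul_eq_mul] using this
  have hp₁ := hp e₁; have hp₂ := hp e₂; have hm₁ := hm e₁; have hm₂ := hm e₂
  rintro (h | h)
  · have h1 := ev h e₁
    have h2 := ev h e₂
    rw [he₁] at h1
    rw [he₂] at h2
    interval_cases (ρp e₂) <;> interval_cases (ρm e₂) <;> simp at h2 <;>
      interval_cases (ρp e₁) <;> interval_cases (ρm e₁) <;> omega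
  · have h1 := ev h e₁
    have h2 := ev h e₂
    rw [he₁] at h1
    rw [he₂] at h2
    interval_cases (ρp e₂) <;> interval_cases (ρm e₂) <;> simp at h2 <;>
      interval_cases (ρp e₁) <;> interval_cases (ρm e₁) <;> omega

/-- A unit pair on two distinct letters is `{0,1}`-valued. [folklore] -/
theorem unit_pair_le_one {c d : Expo} (hcd : c ≠ d) (e : Expo) :
    (Finsupp.single c 1 + Finsupp.single d 1 : Expo →₀ ℕ) e ≤ 1 := by
  rw [Finsupp.add_apply, Finsupp.single_apply, Finsupp.single_apply]
  by_cases h1 : c = e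
  · have h2 : ¬ d = e := fun h2 => hcd (h1.trans h2.symm)
    simp [h1, h2]
  · simp only [if_neg h1, zero_add]
    split_ifs <;> simp

/-- A datum with `ρm = p • e_α` has `ρp < ρm` at most at `α`. [folklore] -/
theorem oneSided_of_single_right (ρp : Expo →₀ ℕ) (α : Expo) (p : ℕ) :
    ∀ e e', ρp e < (Finsupp.single α p) e → ρp e' < (Finsupp.single α p) e' → e = e' := by
  intro e e' h h'
  by_cases hea : e = α
  · by_cases hea' : e' = α
    · rw [hea, hea']
    · rw [Finsupp.single_apply, if_neg (Ne.symm hea')] at h'; omega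
  · rw [Finsupp.single_apply, if_neg (Ne.symm hea)] at h; omega

/-- A datum with `ρp = p • e_β` has `ρm < ρp` at most at `β`. [folklore] -/
theorem oneSided_of_single_left (ρm : Expo →₀ ℕ) (β : Expo) (p : ℕ) :
    ∀ e e', ρm e < (Finsupp.single β p) e → ρm e' < (Finsupp.single β p) e' → e = e' :=
  oneSided_of_single_right ρm β p

/-! ### Three-position tuples `(x | y | z)` in a shared alphabet -/

section Triple

variable {i j k : Fin m} (hij : i ≠ j) (hik : i ≠ k) (hjk : j ≠ k)
include hij hik hjk

omit hjk in
/-- Value of a triple tuple at its first position. [folklore] -/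
theorem triple_at_i (x y z : Expo) : (Pi.single i x + Pi.single j y + Pi.single k z : Fin m → Expo) i = x := by
  simp [Pi.single_eq_of_ne hij, Pi.single_eq_of_ne hik]

omit hik in
/-- Value of a triple tuple at its second position. [folklore] -/
theorem triple_at_j (x y z : Expo) : (Pi.single i x + Pi.single j y + Pi.single k z : Fin m → Expo) j = y := by
  simp [Pi.single_eq_of_ne hij.symm, Pi.single_eq_of_ne hjk]

omit hij in
/-- Value of a triple tuple at its third position. [folklore] -/
theorem triple_at_k (x y z : Expo) : (Pi.single i x + Pi.single j y + Pi.single k z : Fin m → Expo) k = z := by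
  simp [Pi.single_eq_of_ne hik.symm, Pi.single_eq_of_ne hjk.symm]

omit hij hik hjk in
/-- A triple tuple vanishes off its three positions. [folklore] -/
theorem triple_of_ne {l : Fin m} (hi : l ≠ i) (hj : l ≠ j) (hk : l ≠ k) (x y z : Expo) :
    (Pi.single i x + Pi.single j y + Pi.single k z : Fin m → Expo) l = 0 := by
  simp [Pi.single_eq_of_ne hi, Pi.single_eq_of_ne hj, Pi.single_eq_of_ne hk]

/-- A triple tuple with values in `E ∪ {0}` is a letter tuple of the shared-alphabet family. [folklore] -/
theorem triple_mem_tuples {E : Finset Expo} {A : Fin m → Finset Expo} (hA : ∀ l, A l = E) {x y z : Expo}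
    (hx : x ∈ insert (0 : Expo) E) (hy : y ∈ insert (0 : Expo) E) (hz : z ∈ insert (0 : Expo) E) :
    (Pi.single i x + Pi.single j y + Pi.single k z : Fin m → Expo) ∈ tuples A := by
  unfold tuples
  rw [Fintype.mem_piFinset]
  intro l
  rw [hA l]
  by_cases hi : l = i
  · subst hi; rwa [triple_at_i hij hik]
  by_cases hj : l = j
  · subst hj; rwa [triple_at_j hij hjk]
  by_cases hk : l = k
  · subst hk; rwa [triple_at_k hik hjk]
  rw [triple_of_ne hi hj hk]; exact Finset.mem_insert_self _ _

omit hij hik hjk in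
/-- The sum of a triple tuple. [folklore] -/
theorem sum_triple (x y z : Expo) : ∑ l, (Pi.single i x + Pi.single j y + Pi.single k z : Fin m → Expo) l = x + y + z := by
  simp [Finset.sum_add_distrib, Finset.sum_pi_single']

/-- Letter multiset of a triple tuple: one copy of each non-zero entry. [folklore] -/
theorem msetT_triple (x y z : Expo) :
    msetT (Pi.single i x + Pi.single j y + Pi.single k z : Fin m → Expo) =
      (if x = 0 then 0 else Finsupp.single x 1) + (if y = 0 then 0 else Finsupp.single y 1) +
        (if z = 0 then 0 else Finsupp.single z 1) := by
  unfold msetT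
  rw [Fintype.sum_eq_add_sum_compl i, triple_at_i hij hik]
  have hj' : j ∈ ({i}ᶜ : Finset (Fin m)) := by simp [hij.symm]
  rw [← Finset.add_sum_erase _ _ hj', triple_at_j hij hjk]
  have hk' : k ∈ (({i}ᶜ : Finset (Fin m)).erase j) := by simp [hjk.symm, hik.symm]
  rw [← Finset.add_sum_erase _ _ hk', triple_at_k hik hjk]
  rw [Finset.sum_eq_zero, add_zero, add_assoc]
  intro l hl
  simp only [Finset.mem_erase, Finset.mem_compl, Finset.mem_singleton] at hl
  rw [triple_of_ne hl.2.2 hl.2.1 hl.1, if_pos rfl]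

end Triple

/-! ### The two-sided family `α + 2β = γ + δ` -/

section TwoSided

variable {E : Finset Expo} {A : Fin m → Finset Expo} (hA : ∀ l, A l = E) {α β γ δ : Expo}
  (hα : α ∈ E) (hβ : β ∈ E) (hγ : γ ∈ E) (hδ : δ ∈ E) (hα0 : α ≠ 0) (hβ0 : β ≠ 0) (hγ0 : γ ≠ 0) (hδ0 : δ ≠ 0)
  (hαβ : α ≠ β) (hαγ : α ≠ γ) (hαδ : α ≠ δ) (hβγ : β ≠ γ) (hβδ : β ≠ δ) (hγδ : γ ≠ δ)
  (hrel : α + 2 • β = γ + δ) {i j k : Fin m} (hij : i ≠ j) (hik : i ≠ k) (hjk : j ≠ k)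
include hA hα hβ hγ hδ hα0 hβ0 hγ0 hδ0 hαβ hαγ hαδ hβγ hβδ hγδ hrel hij hik hjk

omit hαβ hαγ hαδ hβγ hβδ hγδ in
/-- **Master lemma of the family**: every datum satisfying `RankOneCoincidences` must relate `P = e_α + 2e_β` and `Q = e_γ + e_δ` by a
`k`-shift. [folklore] -/
theorem shift_of_rankOne {ρp ρm : Expo →₀ ℕ} (h : RankOneCoincidences A ρp ρm) :
    ∃ k : ℕ, (Finsupp.single α 1 + Finsupp.single β 1 + Finsupp.single β 1 : Expo →₀ ℕ) + k • ρp =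
        (Finsupp.single γ 1 + Finsupp.single δ 1) + k • ρm ∨
      (Finsupp.single γ 1 + Finsupp.single δ 1 : Expo →₀ ℕ) + k • ρp =
        (Finsupp.single α 1 + Finsupp.single β 1 + Finsupp.single β 1) + k • ρm := by
  have ha := triple_mem_tuples hij hik hjk hA (Finset.mem_insert_of_mem hα) (Finset.mem_insert_of_mem hβ)
    (Finset.mem_insert_of_mem hβ)
  have hb := triple_mem_tuples hij hik hjk hA (Finset.mem_insert_of_mem hγ) (Finset.mem_insert_of_mem hδ)
    (Finset.mem_insert_self (0 : Expo) E)
  have hsum : ∑ l, (Pi.single i α + Pi.single j β + Pi.single k β : Fin m → Expo) l =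
      ∑ l, (Pi.single i γ + Pi.single j δ + Pi.single k (0 : Expo) : Fin m → Expo) l := by
    rw [sum_triple, sum_triple, add_zero, ← hrel, two_nsmul, add_assoc]
  have hPa : msetT (Pi.single i α + Pi.single j β + Pi.single k β : Fin m → Expo) =
      Finsupp.single α 1 + Finsupp.single β 1 + Finsupp.single β 1 := by
    rw [msetT_triple hij hik hjk, if_neg hα0, if_neg hβ0]
  have hPb : msetT (Pi.single i γ + Pi.single j δ + Pi.single k (0 : Expo) : Fin m → Expo) =
      Finsupp.single γ 1 + Finsupp.single δ 1 := by
    rw [msetT_triple hij hik hjk, if_neg hγ0, if_neg hδ0, if_pos rfl, add_zero]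
  obtain ⟨k, hk⟩ := h _ ha _ hb hsum
  rw [hPa, hPb] at hk
  exact ⟨k, hk⟩

/-- **No one-sided datum fits the two-sided family.** [folklore] -/
theorem no_oneSided_datum (ρp ρm : Expo →₀ ℕ)
    (hone : (∀ e e', ρp e < ρm e → ρp e' < ρm e' → e = e') ∨ (∀ e e', ρm e < ρp e → ρm e' < ρp e' → e = e')) :
    ¬ RankOneCoincidences A ρp ρm := by
  intro h
  obtain ⟨k, hk⟩ := shift_of_rankOne hA hα hβ hγ hδ hα0 hβ0 hγ0 hδ0 hrel hij hik hjk h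
  refine no_shift_of_oneSided (e₁ := α) (e₂ := β) (f₁ := γ) (f₂ := δ) hαβ hγδ ?_ ?_ ?_ ?_ hone k hk
  · simp [hαβ, hαγ, hαδ]
  · simp [Ne.symm hαβ, hβγ, hβδ]
  · simp [Ne.symm hαγ, Ne.symm hβγ, hγδ]
  · simp [Ne.symm hαδ, Ne.symm hβδ, Ne.symm hγδ]

omit hγδ in
/-- **No unit (`{0,1}`-valued) datum fits the two-sided family.** [folklore] -/
theorem no_unit_datum (ρp ρm : Expo →₀ ℕ) (hp : ∀ e, ρp e ≤ 1) (hm : ∀ e, ρm e ≤ 1) :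
    ¬ RankOneCoincidences A ρp ρm := by
  intro h
  obtain ⟨k, hk⟩ := shift_of_rankOne hA hα hβ hγ hδ hα0 hβ0 hγ0 hδ0 hrel hij hik hjk h
  refine no_shift_of_unit (e₁ := α) (e₂ := β) ?_ ?_ hp hm k hk
  · simp [hαβ, hαγ, hαδ]
  · simp [Ne.symm hαβ, hβγ, hβδ]

/-- **The family satisfies all seven `¬`-clauses of `ResidualLawV20` and `¬ OneSidedRankOne`** (bodies of the v20 skeleton's defs
`FourTermRankOne`, `ThreeTermRankOne`, `ThreeTermAPRankOne`, `ThreeTermFreeRankOne`, `ThreeTermHomRankOne`, `ThreeTermGenRankOne`,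
`TwoTermRankOne`, verbatim, in this order, then the typed R8 target `OneSidedRankOne` — one-sided `p·α = Σ q_i β_i`, any `k ≥ 1` —
verbatim). [folklore] -/
theorem escapes_residualV20_and_R8_clauses :
    (¬ ∃ α β γ δ : Expo, α ≠ β ∧ α ≠ γ ∧ α ≠ δ ∧ β ≠ γ ∧ β ≠ δ ∧ γ ≠ δ ∧ α + β = γ + δ ∧
        RankOneCoincidences A (Finsupp.single γ 1 + Finsupp.single δ 1) (Finsupp.single α 1 + Finsupp.single β 1)) ∧
    (¬ ∃ α β γ : Expo, α ≠ β ∧ α ≠ γ ∧ β ≠ γ ∧ α = β + γ ∧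
        RankOneCoincidences A (Finsupp.single β 1 + Finsupp.single γ 1) (Finsupp.single α 1)) ∧
    (¬ ∃ α β γ : Expo, α ≠ β ∧ α ≠ γ ∧ β ≠ γ ∧ α + γ = β + β ∧
        RankOneCoincidences A (Finsupp.single β 2) (Finsupp.single α 1 + Finsupp.single γ 1)) ∧
    (¬ ∃ (α β γ : Expo) (q r : ℕ), 1 ≤ q ∧ 1 ≤ r ∧ α ≠ β ∧ α ≠ γ ∧ β ≠ γ ∧ α = q • β + r • γ ∧
        RankOneCoincidences A (Finsupp.single β q + Finsupp.single γ r) (Finsupp.single α 1)) ∧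
    (¬ ∃ α β γ : Expo, ∃ q r : ℕ, α ≠ β ∧ α ≠ γ ∧ β ≠ γ ∧ 1 ≤ q ∧ 1 ≤ r ∧ q • α + r • γ = (q + r) • β ∧
        RankOneCoincidences A (Finsupp.single β (q + r)) (Finsupp.single α q + Finsupp.single γ r)) ∧
    (¬ ∃ (α β γ : Expo) (p q r : ℕ), 1 ≤ p ∧ 1 ≤ q ∧ 1 ≤ r ∧ α ≠ β ∧ α ≠ γ ∧ β ≠ γ ∧ p • α = q • β + r • γ ∧
        RankOneCoincidences A (Finsupp.single β q + Finsupp.single γ r) (Finsupp.single α p)) ∧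
    (¬ ∃ (α β : Expo) (p q : ℕ), 1 ≤ p ∧ 1 ≤ q ∧ α ≠ β ∧ p • α = q • β ∧
        RankOneCoincidences A (Finsupp.single β q) (Finsupp.single α p)) ∧
    (¬ ∃ (α : Expo) (p k : ℕ) (β : Fin k → Expo) (q : Fin k → ℕ), 1 ≤ p ∧ 1 ≤ k ∧ (∀ i, 1 ≤ q i) ∧ Function.Injective β ∧
        (∀ i, β i ≠ α) ∧ p • α = ∑ i, q i • β i ∧
        RankOneCoincidences A (∑ i, Finsupp.single (β i) (q i)) (Finsupp.single α p)) := by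
  have NO := no_oneSided_datum hA hα hβ hγ hδ hα0 hβ0 hγ0 hδ0 hαβ hαγ hαδ hβγ hβδ hγδ hrel hij hik hjk
  have NU := no_unit_datum hA hα hβ hγ hδ hα0 hβ0 hγ0 hδ0 hαβ hαγ hαδ hβγ hβδ hrel hij hik hjk
  refine ⟨?_, ?_, ?_, ?_, ?_, ?_, ?_, ?_⟩
  · rintro ⟨a, b, c, d, hab, -, -, -, -, hcd, -, hR⟩
    exact NU _ _ (unit_pair_le_one hcd) (unit_pair_le_one hab) hR
  · rintro ⟨a, b, c, -, -, -, -, hR⟩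
    exact NO _ _ (Or.inl (oneSided_of_single_right _ a 1)) hR
  · rintro ⟨a, b, c, -, -, -, -, hR⟩
    exact NO _ _ (Or.inr (oneSided_of_single_left _ b 2)) hR
  · rintro ⟨a, b, c, q, r, -, -, -, -, -, -, hR⟩
    exact NO _ _ (Or.inl (oneSided_of_single_right _ a 1)) hR
  · rintro ⟨a, b, c, q, r, -, -, -, -, -, -, hR⟩
    exact NO _ _ (Or.inr (oneSided_of_single_left _ b (q + r))) hR
  · rintro ⟨a, b, c, p, q, r, -, -, -, -, -, -, -, hR⟩
    exact NO _ _ (Or.inl (oneSided_of_single_right _ a p)) hR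
  · rintro ⟨a, b, p, q, -, -, -, -, hR⟩
    exact NO _ _ (Or.inl (oneSided_of_single_right _ a p)) hR
  · rintro ⟨a, p, n, b, q, -, -, -, -, -, -, hR⟩
    exact NO _ _ (Or.inl (oneSided_of_single_right _ a p)) hR

end TwoSided

/-! ### Non-vacuity of the letter hypotheses: `β = (3,0), α = (0,1), γ = (1,0), δ = (5,1)`, three positions -/

/-- The concrete two-sided alphabet `{(0,1), (3,0), (1,0), (5,1)}` (`α + 2β = γ + δ = (6,1)`) on `Fin 3` escapes every one-sided
datum. [folklore] -/
theorem example_escapes (ρp ρm : Expo →₀ ℕ)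
    (hone : (∀ e e', ρp e < ρm e → ρp e' < ρm e' → e = e') ∨ (∀ e e', ρm e < ρp e → ρm e' < ρp e' → e = e')) :
    ¬ RankOneCoincidences
      (fun _ : Fin 3 => ({Finsupp.single 1 1, Finsupp.single 0 3, Finsupp.single 0 1,
        Finsupp.single 0 5 + Finsupp.single 1 1} : Finset Expo)) ρp ρm := by
  refine no_oneSided_datum
    (E := {Finsupp.single 1 1, Finsupp.single 0 3, Finsupp.single 0 1, Finsupp.single 0 5 + Finsupp.single 1 1})
    (fun _ => rfl) (α := Finsupp.single 1 1) (β := Finsupp.single 0 3) (γ := Finsupp.single 0 1)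
    (δ := Finsupp.single 0 5 + Finsupp.single 1 1) (by simp) (by simp) (by simp) (by simp)
    ?_ ?_ ?_ ?_ ?_ ?_ ?_ ?_ ?_ ?_ ?_ (i := 0) (j := 1) (k := 2) (by decide) (by decide) (by decide) ρp ρm hone
  all_goals
    first
      | exact Finsupp.single_ne_zero.mpr (by norm_num)
      | (intro h; have h0 := DFunLike.congr_fun h 0; have h1 := DFunLike.congr_fun h 1;
          simp at h0 h1)
      | (ext s; fin_cases s <;> simp)

end Summit.ValiantsHypothesis.Theorems.TwoProducts.Negative.TwoSidedEscape
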